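import Summits.KontsevichZagierPeriods.KontsevichZagierPeriods.Theses.SymplecticScissors
import Literature.NumberTheory.Transcendental.AyoubPeriodSeries
import Literature.NumberTheory.Transcendental.AyoubPeriodSeriesKernel
import Literature.NumberTheory.Transcendental.AyoubPeriodSeriesPiAlgebraic
import Summits.KontsevichZagierPeriods.KontsevichZagierPeriods.Theorems.UnfoldedStokesStokesGenerationStubSpanToRepsAuxCoeff
import Mathlib.RingTheory.MvPowerSeries.Rename
import Mathlib.RingTheory.MvPowerSeries.Substitution
import Mathlib.Algebra.MvPolynomial.Funext

/-!
# `TypeAGeneration` (stmt-KontsevichZagierPeriods-18392), line `Sketch`: stub `stub_substRoom` (S3), auxiliary file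

Crux `Summit.KontsevichZagierPeriods.KontsevichZagierPeriods.Theses.SymplecticScissors.TypeAGeneration`
(Ayoub 2015 Conj. 1.1 = Fresán 2024 Conj. 3.5), line `Sketch` (radius amplification inside Ayoub's
algebra `𝒪_{k-alg}(𝔻̄^∞) = AyoubRel.Oan σ`). Stub S3 concerns the substituted series
`T = F(zᵢ(1 − μ z_j), w) = MvPowerSeries.subst a F`, `a i = zᵢ − μ zᵢ z_j`, `a l = z_l` (`l ≠ i`),
for `F` free of the fresh variable `z_j` (`i ≠ j`).

This auxiliary file proves (all `[folklore]`; no definition is introduced, the family `a` is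
written out as `fun l => if l = i then zᵢ − μ zᵢ z_j else z_l` throughout):

* `s3_hasSubst`: the family `a` is substitutable;
* `s3_coeff_subst`: the **coefficient formula** `T_e = F_{e − e_j e_j} · C(eᵢ, e_j) (−μ)^{e_j}`
  (only `d = e − e_j e_j` contributes to `MvPowerSeries.coeff_subst`; binomial expansion of
  `(1 − μ z_j)^{dᵢ}`), and its fibre form `s3_coeff_subst_add_single`;
* `s3_usesVar`: `T` involves only `z_j` and the variables of `F`;
* `s3_polyMap_injective`: the `k`-algebra map `zᵢ ↦ zᵢ − μ zᵢ z_j` of `k[z]` is injective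
  (`MvPolynomial.funext` over the infinite field `k`, after multiplying by `1 − μ z_j`);
* `s3_isAlgebraic`: `T` is algebraic over `k(z)` (transport of `P(F) = 0` along the square
  `subst a ∘ polyToCSeries σ = polyToCSeries σ ∘ (zᵢ ↦ zᵢ − μ zᵢ z_j)`);
* the registered auxiliary stub `stub_substRoomAux` packaging the coefficient formula and the
  algebraicity transfer.

The main file `SymplecticScissorsTypeAGenerationStubSubstRoom.lean` adds the anisotropic weights,
the polyradius and the registered stub `stub_substRoom`.
-/

noncomputable section

-- `Summit.KontsevichZagierPeriods.KontsevichZagierPeriods.…` is the tree's mandated layout (single-conjunct summit).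
set_option linter.dupNamespace false

namespace Summit.KontsevichZagierPeriods.KontsevichZagierPeriods.TypeAGenerationLine

open Finsupp MvPowerSeries
open Literature.NumberTheory.Transcendental
open Literature.NumberTheory.Transcendental.AyoubRel
open Summit.KontsevichZagierPeriods.KontsevichZagierPeriods.Theses.SymplecticScissors (TypeAGeneration)

/-! ## The substitution `zᵢ ↦ zᵢ (1 − μ z_j)` on `ℂ[[z]]` -/

/-- The family `a = (zᵢ − μ zᵢ z_j; z_l for l ≠ i)` is substitutable (no constant terms;
coefficientwise finite). [folklore] -/
theorem s3_hasSubst (i j : ℕ) (μ : ℂ) :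
    HasSubst (fun l : ℕ => if l = i then (X i - C μ * (X i * X j) : CSeries) else X l) := by
  classical
  refine ⟨fun l => ?_, fun d => ?_⟩
  · have h0 : constantCoeff (if l = i then (X i - C μ * (X i * X j) : CSeries) else X l) = 0 := by
      split_ifs <;> simp [constantCoeff_X]
    show IsNilpotent (constantCoeff (if l = i then (X i - C μ * (X i * X j) : CSeries) else X l))
    rw [h0]
    exact IsNilpotent.zero
  · refine (d.support.finite_toSet.union (Set.finite_singleton i)).subset fun l hl => ?_
    simp only [Set.mem_setOf_eq] at hl
    by_cases hli : l = i
    · exact Or.inr hli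
    · left
      rw [if_neg hli, coeff_X] at hl
      split_ifs at hl with hd
      · rw [Finset.mem_coe, hd, mem_support_iff, single_eq_same]
        exact one_ne_zero
      · exact absurd rfl hl

/-- `∏_s (a s)^{d s} = z^d · (1 − μ z_j)^{d i}` for the family `a = (zᵢ − μ zᵢ z_j; z_l)`. [folklore] -/
theorem s3_prod_pow (i j : ℕ) (μ : ℂ) (d : ℕ →₀ ℕ) :
    (d.prod fun s n => (fun l : ℕ => if l = i then (X i - C μ * (X i * X j) : CSeries) else X l) s ^ n) =
      monomial d 1 * (1 - C μ * X j) ^ (d i) := by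
  classical
  set b : ℕ → CSeries := fun l => if l = i then 1 - C μ * X j else 1 with hb
  have hab : ∀ l : ℕ, (fun l : ℕ => if l = i then (X i - C μ * (X i * X j) : CSeries) else X l) l = X l * b l := by
    intro l
    by_cases hl : l = i
    · subst hl
      simp only [hb, if_true]
      ring
    · simp only [hb, if_neg hl, mul_one]
  have h1 : (d.prod fun s n => (fun l : ℕ => if l = i then (X i - C μ * (X i * X j) : CSeries) else X l) s ^ n) =
      (d.prod fun s n => X s ^ n) * d.prod fun s n => b s ^ n := by
    simp only [Finsupp.prod, hab, mul_pow]
    exact Finset.prod_mul_distrib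
  have h2 : (d.prod fun s n => b s ^ n) = (1 - C μ * X j) ^ (d i) := by
    rw [Finsupp.prod, Finset.prod_eq_single i]
    · simp only [hb, if_true]
    · intro l _ hli
      simp only [hb, if_neg hli, one_pow]
    · intro hi
      rw [notMem_support_iff.mp hi, pow_zero]
  rw [h1, h2, ← monomial_one_eq]

/-- Coefficients of `(1 − μ z_j)^n`: `C(n, m) (−μ)^m` on `z_j^m`, zero off the `z_j`-axis. [folklore] -/
theorem s3_coeff_one_sub_pow (j : ℕ) (μ : ℂ) (n : ℕ) (f : ℕ →₀ ℕ) :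
    coeff f ((1 - C μ * X j : CSeries) ^ n) =
      if f = single j (f j) then ((n.choose (f j) : ℕ) : ℂ) * (-μ) ^ (f j) else 0 := by
  classical
  have hx : (1 - C μ * X j : CSeries) = C (-μ) * X j + 1 := by
    rw [map_neg]; ring
  rw [hx, add_pow, map_sum]
  have hterm : ∀ m : ℕ, coeff f ((C (-μ) * X j : CSeries) ^ m * 1 ^ (n - m) * (n.choose m : CSeries)) =
      if f = single j m then ((n.choose m : ℕ) : ℂ) * (-μ) ^ m else 0 := by
    intro m
    rw [one_pow, mul_one, ← map_natCast (C : ℂ →+* CSeries), coeff_mul_C, mul_pow, ← map_pow,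
      coeff_C_mul, coeff_X_pow]
    split_ifs <;> ring
  simp only [hterm]
  by_cases hf : f = single j (f j)
  · rw [if_pos hf]
    have heq : ∀ m, (f = single j m ↔ f j = m) := by
      intro m
      constructor
      · intro h
        rw [h, single_eq_same]
      · intro h
        rw [← h]
        exact hf
    simp only [heq]
    rw [Finset.sum_ite_eq]
    split_ifs with hm
    · rfl
    · rw [Finset.mem_range] at hm
      rw [Nat.choose_eq_zero_of_lt (by omega), Nat.cast_zero, zero_mul]
  · rw [if_neg hf]
    refine Finset.sum_eq_zero fun m _ => ?_
    rw [if_neg]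
    intro h
    apply hf
    rw [h, single_eq_same]

/-- **Coefficient formula for `T = F(zᵢ(1 − μ z_j), w)`**, `F` free of `z_j`, `i ≠ j`:
`T_e = F_{e − m e_j} · C(eᵢ, m) (−μ)^m` with `m = e_j`. [folklore] -/
theorem s3_coeff_subst {F : CSeries} {i j : ℕ} (hij : i ≠ j) (hj : ¬ UsesVar F j) (μ : ℂ)
    (e : ℕ →₀ ℕ) :
    coeff e (subst (fun l : ℕ => if l = i then (X i - C μ * (X i * X j) : CSeries) else X l) F) =
      coeff (e.erase j) F * ((((e i).choose (e j) : ℕ) : ℂ) * (-μ) ^ (e j)) := by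
  classical
  have hF0 : ∀ d : ℕ →₀ ℕ, d j ≠ 0 → coeff d F = 0 := by
    intro d hd
    by_contra hne
    exact hj ⟨d, hd, hne⟩
  have hle : e.erase j ≤ e := by
    intro l
    by_cases hl : l = j
    · rw [hl, erase_same]; exact Nat.zero_le _
    · rw [erase_ne hl]
  have hsub : e - e.erase j = single j (e j) := by
    ext l
    by_cases hl : l = j
    · rw [hl, tsub_apply, erase_same, single_eq_same, Nat.sub_zero]
    · rw [tsub_apply, erase_ne hl, single_eq_of_ne hl, Nat.sub_self]
  rw [coeff_subst (s3_hasSubst i j μ), finsum_eq_single _ (e.erase j)]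
  · rw [smul_eq_mul, s3_prod_pow, coeff_monomial_mul, if_pos hle, one_mul, hsub,
      s3_coeff_one_sub_pow, single_eq_same, if_pos rfl, erase_ne hij]
  · intro d hd
    rw [smul_eq_mul]
    by_cases hdj : d j = 0
    · rw [s3_prod_pow, coeff_monomial_mul]
      split_ifs with hde
      · rw [s3_coeff_one_sub_pow, if_neg, mul_zero, mul_zero]
        intro hsingle
        apply hd
        ext l
        by_cases hl : l = j
        · rw [hl, hdj, erase_same]
        · rw [erase_ne hl]
          have h1 : (e - d) l = 0 := by
            rw [hsingle, single_eq_of_ne hl]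
          rw [tsub_apply] at h1
          have h2 : d l ≤ e l := hde l
          omega
      · rw [mul_zero]
    · rw [hF0 d hdj, zero_mul]

/-- Coefficient formula on the fibre `e = d + m e_j`, `d_j = 0`:
`T_{d + m e_j} = F_d · C(dᵢ, m) (−μ)^m`. [folklore] -/
theorem s3_coeff_subst_add_single {F : CSeries} {i j : ℕ} (hij : i ≠ j) (hj : ¬ UsesVar F j)
    (μ : ℂ) {d : ℕ →₀ ℕ} (hd : d j = 0) (m : ℕ) :
    coeff (d + single j m) (subst (fun l : ℕ => if l = i then (X i - C μ * (X i * X j) : CSeries) else X l) F) =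
      coeff d F * ((((d i).choose m : ℕ) : ℂ) * (-μ) ^ m) := by
  classical
  have h1 : (d + single j m).erase j = d := by
    ext l
    by_cases hl : l = j
    · rw [hl, erase_same, hd]
    · rw [erase_ne hl, Finsupp.add_apply, single_eq_of_ne hl, add_zero]
  rw [s3_coeff_subst hij hj μ, h1, Finsupp.add_apply, Finsupp.add_apply, single_eq_same,
    single_eq_of_ne hij, hd, zero_add, add_zero]

/-- **Variables of `T`**: `T` involves only `z_j` and the variables of `F`. [folklore] -/
theorem s3_usesVar {F : CSeries} {i j : ℕ} (hij : i ≠ j) (hj : ¬ UsesVar F j) (μ : ℂ) (l : ℕ)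
    (h : UsesVar (subst (fun l : ℕ => if l = i then (X i - C μ * (X i * X j) : CSeries) else X l) F) l) :
    l = j ∨ UsesVar F l := by
  classical
  obtain ⟨e, hel, hne⟩ := h
  by_cases hlj : l = j
  · exact Or.inl hlj
  · right
    rw [s3_coeff_subst hij hj μ] at hne
    refine ⟨e.erase j, ?_, left_ne_zero_of_mul hne⟩
    rwa [erase_ne hlj]

/-! ## Algebraicity: transport along `zᵢ ↦ zᵢ − μ zᵢ z_j` on `k[z]` -/

section Alg

variable {k : Type} [Field k]

/-- **`zᵢ ↦ zᵢ − μ zᵢ z_j` is injective on `k[z]`** (`char k = 0`, `i ≠ j`): evaluating the image of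
`q` at `x` evaluates `q` at `x[i ↦ xᵢ (1 − μ x_j)]`; so if the image vanishes, `q` vanishes at every
point `y` with `1 − μ y_j ≠ 0` (take `xᵢ = yᵢ / (1 − μ y_j)`), hence `(1 − μ z_j) q` vanishes
identically on the infinite field `k` and is `0` (`MvPolynomial.funext`), and `k[z]` is a domain.
[folklore] -/
theorem s3_polyMap_injective [CharZero k] {i j : ℕ} (hij : i ≠ j) (μ : k) :
    Function.Injective (MvPolynomial.bind₁ fun l : ℕ =>
      if l = i then MvPolynomial.X i - MvPolynomial.C μ * (MvPolynomial.X i * MvPolynomial.X j)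
      else MvPolynomial.X l) := by
  set g : ℕ → MvPolynomial ℕ k := fun l : ℕ =>
    if l = i then MvPolynomial.X i - MvPolynomial.C μ * (MvPolynomial.X i * MvPolynomial.X j)
    else MvPolynomial.X l with hg
  have heval : ∀ (q : MvPolynomial ℕ k) (x : ℕ → k), MvPolynomial.eval x (MvPolynomial.bind₁ g q) =
      MvPolynomial.eval (Function.update x i (x i * (1 - μ * x j))) q := by
    intro q x
    have hfun : (fun l => MvPolynomial.eval x (g l)) = Function.update x i (x i * (1 - μ * x j)) := by
      funext l
      by_cases hl : l = i
      · rw [hl, Function.update_self]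
        simp only [hg, if_true, map_sub, map_mul, MvPolynomial.eval_X, MvPolynomial.eval_C]
        ring
      · rw [Function.update_of_ne hl]
        simp only [hg, if_neg hl, MvPolynomial.eval_X]
    rw [← hfun]
    exact MvPolynomial.eval₂Hom_bind₁ _ _ _ _
  rw [injective_iff_map_eq_zero]
  intro q hq
  have key : ∀ y : ℕ → k,
      MvPolynomial.eval y ((1 - MvPolynomial.C μ * MvPolynomial.X j) * q) = 0 := by
    intro y
    rw [map_mul, map_sub, map_one, map_mul, MvPolynomial.eval_C, MvPolynomial.eval_X]
    by_cases hy : 1 - μ * y j = 0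
    · rw [hy, zero_mul]
    · have h := congrArg (MvPolynomial.eval (Function.update y i (y i / (1 - μ * y j)))) hq
      rw [map_zero, heval, Function.update_idem, Function.update_self,
        Function.update_of_ne (Ne.symm hij), div_mul_cancel₀ _ hy, Function.update_eq_self] at h
      rw [h, mul_zero]
  have h1 : (1 - MvPolynomial.C μ * MvPolynomial.X j) * q = 0 :=
    MvPolynomial.funext fun y => by rw [key, map_zero]
  have hne : (1 - MvPolynomial.C μ * MvPolynomial.X j : MvPolynomial ℕ k) ≠ 0 := by
    intro h0
    have h := congrArg MvPolynomial.constantCoeff h0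
    rw [map_sub, map_one, map_mul, MvPolynomial.constantCoeff_X, mul_zero, sub_zero, map_zero] at h
    exact one_ne_zero h
  exact (mul_eq_zero.mp h1).resolve_left hne

variable (σ : k →+* ℂ)

/-- `polyToCSeries σ (z_l) = z_l`. [folklore] -/
theorem s3_polyToCSeries_X (l : ℕ) : polyToCSeries σ (MvPolynomial.X l) = X l := by
  simp [polyToCSeries, MvPolynomial.coe_X]

/-- `polyToCSeries σ (c) = σ c` as a constant series. [folklore] -/
theorem s3_polyToCSeries_C (c : k) : polyToCSeries σ (MvPolynomial.C c) = C (σ c) := by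
  simp [polyToCSeries, MvPolynomial.map_C, MvPolynomial.coe_C]

/-- **Algebraicity of `T`** by transport of an algebraic relation `P(F) = 0` over `k[z]` along the
injective substitution `f = (zᵢ ↦ zᵢ − μ zᵢ z_j)` of `k[z]`: the square
`subst a ∘ polyToCSeries σ = polyToCSeries σ ∘ f` commutes (both ring maps out of `k[z]` agree on
constants and variables; `σ μ = μ` for rational `μ`), so `(P^f)(T) = subst a (P(F)) = 0` with
`P^f ≠ 0`. [folklore] -/
theorem s3_isAlgebraic [CharZero k] {F : CSeries} (hF : IsAlgebraicOverRatFunc σ F) {i j : ℕ}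
    (hij : i ≠ j) (μ : ℚ) :
    IsAlgebraicOverRatFunc σ
      (subst (fun l : ℕ => if l = i then (X i - C (μ : ℂ) * (X i * X j) : CSeries) else X l) F) := by
  set f : MvPolynomial ℕ k →ₐ[k] MvPolynomial ℕ k := MvPolynomial.bind₁ fun l : ℕ =>
    if l = i then MvPolynomial.X i - MvPolynomial.C (μ : k) * (MvPolynomial.X i * MvPolynomial.X j)
    else MvPolynomial.X l with hf
  have hfinj : Function.Injective f.toRingHom := s3_polyMap_injective hij (μ : k)
  set S : CSeries →ₐ[ℂ] CSeries := substAlgHom (s3_hasSubst i j (μ : ℂ)) with hS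
  have hsq : S.toRingHom.comp (polyToCSeries σ) = (polyToCSeries σ).comp f.toRingHom := by
    refine MvPolynomial.ringHom_ext (fun c => ?_) (fun l => ?_)
    · simp only [RingHom.coe_comp, Function.comp_apply, AlgHom.toRingHom_eq_coe, RingHom.coe_coe,
        s3_polyToCSeries_C, hS, substAlgHom_apply, subst_C, hf, MvPolynomial.bind₁_C_right]
    · simp only [RingHom.coe_comp, Function.comp_apply, AlgHom.toRingHom_eq_coe, RingHom.coe_coe,
        s3_polyToCSeries_X, hS, substAlgHom_apply, subst_X (s3_hasSubst i j (μ : ℂ)), hf,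
        MvPolynomial.bind₁_X_right]
      split_ifs with hl
      · rw [map_sub, map_mul, map_mul, s3_polyToCSeries_X, s3_polyToCSeries_X, s3_polyToCSeries_C,
          map_ratCast σ]
      · rw [s3_polyToCSeries_X]
  obtain ⟨P, hP0, hP⟩ := hF
  refine ⟨P.map f.toRingHom, (Polynomial.map_ne_zero_iff hfinj).mpr hP0, ?_⟩
  rw [Polynomial.eval₂_map, ← hsq]
  have hT : subst (fun l : ℕ => if l = i then (X i - C (μ : ℂ) * (X i * X j) : CSeries) else X l) F =
      S.toRingHom F := by
    rw [AlgHom.toRingHom_eq_coe, RingHom.coe_coe, hS, substAlgHom_apply]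
  rw [hT, ← Polynomial.hom_eval₂, hP, map_zero]

end Alg

/-! ## The registered auxiliary stub -/

/-- **S3 (auxiliary stub)**: for `F` free of `z_j` (`i ≠ j`) and rational `μ`, the substituted
series `T = F(zᵢ(1 − μ z_j), w)` has coefficients `T_e = F_{e − e_j e_j} · C(eᵢ, e_j) (−μ)^{e_j}`,
and `T` is algebraic over `k(z)` whenever `F` is. [folklore] -/
theorem stub_substRoomAux :
    ∀ (k : Type) [Field k] [CharZero k] (σ : k →+* ℂ) (F : CSeries) (i j : ℕ), i ≠ j →
      ¬ UsesVar F j → ∀ (μ : ℚ),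
        (∀ e : ℕ →₀ ℕ, MvPowerSeries.coeff e (MvPowerSeries.subst
            (fun l : ℕ => if l = i then (X i - C ((μ : ℚ) : ℂ) * (X i * X j) : CSeries) else X l) F) =
          MvPowerSeries.coeff (e.erase j) F *
            ((((e i).choose (e j) : ℕ) : ℂ) * (-((μ : ℚ) : ℂ)) ^ (e j))) ∧
        (IsAlgebraicOverRatFunc σ F → IsAlgebraicOverRatFunc σ (MvPowerSeries.subst
            (fun l : ℕ => if l = i then (X i - C ((μ : ℚ) : ℂ) * (X i * X j) : CSeries) else X l) F)) :=
  fun _ _ _ σ _ _ _ hij hj μ =>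
    ⟨fun e => s3_coeff_subst hij hj (μ : ℂ) e, fun hF => s3_isAlgebraic σ hF hij μ⟩

end Summit.KontsevichZagierPeriods.KontsevichZagierPeriods.TypeAGenerationLine
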